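import Literature.IUT.HodgeTheaters.InitialThetaDataLocalGroups
import HarnessLib

/-!
# [IUTchI] Def 3.1 (c)(d) / Def 6.1 (v): the `l`-TORSION MONODROMY of `X_F` — the interface DATUM
# «`Δ_X^{ab} ⊗ 𝔽_l ≅ E_F[l]` as `Π_{X_F} → G_F`-modules, and `Π_{X̲_K}` = the preimage of a line»
# (post-freeze ADDITIVE interface module; a NAMED DATUM — nothing is constructed, nothing frozen is touched)

S. Mochizuki, *Inter-universal Teichmüller theory I*, kurims manuscript (May 2020), §3 Definition 3.1 (c) p. 62
l. 4–12 «`l` is a prime number `≥ 5` such that the image of the outer homomorphism `G_F → GL₂(𝔽_l)` determined by the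
`l`-torsion points of `E_F` contains the subgroup `SL₂(𝔽_l) ⊆ GL₂(𝔽_l)`; `K ⊆ F̄` … the finite Galois extension of `F`
determined by the kernel of this homomorphism», (d) p. 62 l. 13–35 «`C̲_K` is a hyperbolic orbicurve of type
`(1, l-tors)±` [cf. [EtTh], Definition 2.1] over `K`, with `K`-core `C_K := C_F ×_F K` … In particular, `C̲_K`
determines, up to `K`-isomorphism, a hyperbolic orbicurve `X̲_K` of type `(1, l-tors)` [cf. [EtTh], Definition 2.1]
over `K`» (where [EtTh] Def 2.1 p. 36: «let `Π̄^ell_X ↠ Q` be a quotient onto a free `(ℤ/lℤ)`-module `Q` of rank `1`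
such that the restricted map `Δ̄^ell_X → Q` is still surjective, but the restricted map `D_x → Q` is trivial. Denote
the corresponding covering by `X̲^log → X^log`», `Δ̄^ell_X = Δ_X^{ab} ⊗ ℤ/lℤ` «a free `(ℤ/lℤ)`-module of rank `2`»
p. 35), and §6 Definition 6.1 (v) p. 158 l. 9–21 «the outer homomorphism `Aut(𝒟^{⊚±}) → GL₂(𝔽_l)/{±1}` arising
from the `l`-torsion points of the elliptic curve `E_F` [i.e., from the Galois action on `Δ_X^{ab} ⊗ 𝔽_l`].
Moreover, it follows from the construction of `X̲_K` that … the image of the above outer homomorphism is equal to a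
subgroup of `GL₂(𝔽_l)/{±1}` that contains a Borel subgroup of `SL₂(𝔽_l)/{±1}` … — i.e., the Borel subgroup
corresponding to the rank one quotient of `Δ_X^{ab} ⊗ 𝔽_l` that gives rise to the covering `X̲_K → X_K`»
([IUTchI] Def 3.1 (c)(d) p.62, Def 6.1 (v) p.158) [claim: Mochizuki2012, status: disputed] (D-0012 claim key, series
status DISPUTED — this file TYPES one interface datum over abc-iut-L5-t2's REAL `InitialThetaData`; nothing of the
series is asserted and no side is taken on [IUTchIII] Cor. 3.12).

## WHY (GAP-LEDGER G-w4d065g3-1 and G-L5t4g3-3, «two faces of ONE interface item», abc-iut-w4-d065 gen 3 07:08Z)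

abc-iut-L5-t2's interface `ThetaGeometry` (frozen; `InitialThetaData.geom`) carries `Π_{X_F} ⊆ Π_{C_F} ↠ G_F`, the
§1 datum `pe` at `k := K` and `Π_{X̲_K}` «of type `(1, l-tors)`» only through INDICES (`PiXbar_relIndex : [Π_X : Π_X̲]
= l`, …); Def 3.1 (c) `ImageContainsSL2` is typed on the POINTS `E_F[l](F̄)` (`galoisAct`).  Print links the two
sides twice — Def 6.1 (v) «[i.e., from the Galois action on `Δ_X^{ab} ⊗ 𝔽_l`]» and «it follows from the construction
of `X̲_K` … the rank one quotient of `Δ_X^{ab} ⊗ 𝔽_l` that gives rise to the covering `X̲_K → X_K`» — and that link is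
what the kit axiom `PMBaseKit.toFlStar_surjective` at the genuine kit (binder `hT` of abc-iut-w4-d065's
`InitialThetaData.toFlStarGlobal_surjective_of_forall_exists_conj`, p428973) and the cusp action of the full
normaliser `N_{Π_{C_F}}(Π_{X̲_K})` (abc-iut-L5-t4's `CuspClassesNormaliserStable`, p430241) rest on.  It is typed
here ONCE, as a named datum, in the form print's two sentences use it.

## WHAT (one `structure`, data + laws; values of `tau` off `Π_{X_F}` are junk and never constrained)

`InitialThetaData.TorsionMonodromy D` = the `l`-torsion monodromy of the once-punctured elliptic curve `X_F`:
the quotient `Π_{X_F} ↠ π₁(E_F) ↠ E_F[l](F̄) ⋊ G_F` (the section of `π₁(E_F) ↠ G_F` at the origin `O ∈ E_F(F)`, i.e.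
at the cusp of `X_F`), recorded by its TRANSLATION PART `tau : Π_{X_F} → E_F[l](F̄)` — a 1-cocycle for the Galois
action `galoisAct ∘ augGF` (`tau_mul`), killed by `l` (`tau_torsion`), mapping `Δ_X` ONTO `E_F[l](F̄)` (`tau_surjOn`:
«`Δ̄^ell_X` … free of rank `2`» = `Δ_X^{ab} ⊗ 𝔽_l ≅ E_F[l]`) — together with the LINE `𝔽_l · gen ⊆ E_F[l](F̄)` whose
rank-one quotient `Q = E_F[l]/𝔽_l·gen` «gives rise to the covering `X̲_K → X_K`»: `Π_{X̲_K} = {k ∈ Π_{X_K} | tau k ∈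
ℤ·gen}` (`mem_PiXund_iff`; on `Π_{X_K} = Π_{X_F} ×_{G_F} G_K` the map `k ↦ tau k mod 𝔽_l·gen` IS a homomorphism onto
`Q`, because `G_K = Ker(G_F → GL₂(𝔽_l))` acts trivially — abc-iut-L5-t2's `mem_galoisSubgroupOf_iff_fixesTorsion` —
and it kills the decomposition group of the cusp, which is the image of the section at `O`: [EtTh] Def 2.1's
«`D_x → Q` is trivial»).

DESIGN NOTE (recorded for the planner; the GAP row's wording «`Π_{X̲_K} ∩ Δ_X` = preimage of a line» is NOT enough):
two open subgroups of `Π_{X_K}` surjecting onto `G_K` with the same intersection with `Δ_X` differ by a class in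
`H¹(G_K, Q)` (the `K`-forms of the geometric cover), and an element of `Π_{X_F}` over a Borel element of `Gal(K/F)`
permutes these forms; so the normaliser of `Π_{X̲_K}` is only controlled by the cocycle on ALL of `Π_{X_K}` (the
`K`-structure «`D_x → Q` trivial»), which is why `tau` is a cocycle on `Π_{X_F}` and `mem_PiXund_iff` quantifies over
`Π_{X_K}`, not over `Δ_X`.

HONEST LABEL.  A NAMED DATUM (binder) of the genuine situation, CONSUMED by name; NOT constructed here (that needs the
comparison `π₁^{ét}(E_{F̄}) ≅ T(E)` — plan/FOUNDATIONS.md row 12 — absent from the tree); no `instance`, no `Prop`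
fact, no notation; an inhabitant is OWED to the semidirect packaging sequel of the NV-L5 register (abc-iut-L5-t1 /
abc-iut-S2 lineages, RULINGS #40 (3)); NOTE that no PRODUCT-type model `Π_{C_F} = G_F × (finite)` (the NV register's
`geometryOf` / `geometryClaimsOf` / `ArrowModel.geometryOf`) can carry it: `tau_mul` + `tau_surjOn` force `G_F` to act
on the `E_F[l]`-part of `Π_{X_F}` THROUGH `Gal(K/F) ⊇ SL₂(𝔽_l)`, which has no nonzero fixed vector — the witness must be a
genuine semidirect extension.  The proof-only companion `InitialThetaDataTorsionMonodromyProofs.lean`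
DERIVES from it + `D.imageContainsSL2` the split-torus sentence `hT` of G-w4d065g3-1 (hence Def 6.1 (v)
surjectivity `Aut(𝒟^{⊚±}) ↠ 𝔽_l^⋇` at the genuine data).  typed ≠ constructed ≠ proved.
-/

noncomputable section

namespace Literature.IUT.HodgeTheaters

open scoped WeierstrassCurve.Affine Classical

universe u v w

section TorsionMonodromy

variable {F : Type u} {K : Type v} {Fbar : Type w} [Field F] [NumberField F] [Field K] [NumberField K]
  [Algebra F K] [Field Fbar] [Algebra F Fbar] [Algebra K Fbar]
  {E : WeierstrassCurve F} [E.IsElliptic] {l : ℕ} {Pb : BadPlacePredicates K}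

namespace InitialThetaData

/-- **The `l`-torsion monodromy of `X_F`** ([IUTchI] Def 3.1 (c)(d) p.62 with [EtTh] Def 2.1 p.36; Def 6.1 (v)
p.158 «the Galois action on `Δ_X^{ab} ⊗ 𝔽_l`», «the rank one quotient of `Δ_X^{ab} ⊗ 𝔽_l` that gives rise to the
covering `X̲_K → X_K`»): the translation part `tau` of `Π_{X_F} ↠ E_F[l](F̄) ⋊ G_F` (split at the cusp `O`) and the
line `𝔽_l·gen` with `Π_{X̲_K} = {k ∈ Π_{X_K} | tau k ∈ ℤ·gen}`.  A NAMED DATUM over `D : InitialThetaData`, consumed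
by name, not constructed here; values of `tau` outside `Π_{X_F}` are unconstrained junk.
([IUTchI] Def 6.1 (v) p.158) [claim: Mochizuki2012, status: disputed] -/
structure TorsionMonodromy (D : InitialThetaData F K Fbar E l Pb) where
  /-- the translation part `τ : Π_{X_F} → E_F[l](F̄)` of the monodromy `Π_{X_F} ↠ E_F[l](F̄) ⋊ G_F`
  (as a function on `Π_{C_F}`; only its values on `Π_{X_F}` are constrained) -/
  tau : D.PiC → GeomPoints Fbar E
  /-- `τ` takes values in the `l`-torsion `E_F[l](F̄)` («`Δ̄^ell_X` … `(ℤ/lℤ)`-module») -/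
  tau_torsion : ∀ g ∈ D.geom.PiX, (l : ℤ) • tau g = 0
  /-- COCYCLE law: `τ(gh) = τ(g) + σ_g · τ(h)` for `g, h ∈ Π_{X_F}`, `σ_g := augGF g ∈ G_F` acting on `E_F[l](F̄)` by
  the Galois action of Def 3.1 (a)(c) (`galoisAct`) — print's «the Galois action on `Δ_X^{ab} ⊗ 𝔽_l`», i.e. the
  GAP row's wording "`Δ_X^{ab} ⊗ 𝔽_l ≅ E_F[l]` as `Π_{C_F} → G_F`-modules" (our encoding) -/
  tau_mul : ∀ g ∈ D.geom.PiX, ∀ h ∈ D.geom.PiX, tau (g * h) = tau g + galoisAct E (D.augGF g) (tau h)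
  /-- «`Δ̄^ell_X` a free `(ℤ/lℤ)`-module of rank `2`» = `E_F[l](F̄)`: `τ` maps the geometric fundamental group
  `Δ_X` ONTO the `l`-torsion points -/
  tau_surjOn : ∀ P : GeomPoints Fbar E, (l : ℤ) • P = 0 → ∃ k ∈ D.DeltaX, tau k = P
  /-- a generator of the LINE `𝔽_l·gen ⊆ E_F[l](F̄)` = the kernel of «the rank one quotient … `Q`» … -/
  gen : GeomPoints Fbar E
  /-- … an `l`-torsion point … -/
  gen_torsion : (l : ℤ) • gen = 0
  /-- … which is nonzero (`Q = E_F[l]/𝔽_l·gen` has rank ONE) -/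
  gen_ne_zero : gen ≠ 0
  /-- «the rank one quotient … that gives rise to the covering `X̲_K → X_K`» ([EtTh] Def 2.1: `Π_X̲ = Ker(Π_X ↠ Q)`,
  «`D_x → Q` trivial»): inside `Π_{X_K} = Π_{X_F} ∩ Π_{C_K}`, `Π_{X̲_K}` is the set of `k` with `τ k ∈ ℤ·gen` -/
  mem_PiXund_iff : ∀ k ∈ D.PiXK, k ∈ D.PiXund ↔ ∃ a : ℤ, tau k = a • gen

end InitialThetaData

end TorsionMonodromy

end Literature.IUT.HodgeTheaters
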